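import Summits.Ventures.PercRepro.C026Pinned

/-!
# The merged graph's D-free sum is `D_K(x) + Δ_{R→K}(x)` (p6, gen 9)

mine-3's identity `Δ(G/xa) = D_K(x) + Δ_{R→K}(x)` (§27.14: `bot(G/xa) = bot_K(G) ⊔ bot_R(G)`): the
total score of the merged graph `G.mergeInto x a` over its `bot` configurations splits by the witness
`x ~ a` into `pinK` and `pinRK` (`pinK_add_pinRK`), so the pin package `P(x)` gives the D-free
inequality of the merged graph (`dFreeIneq_mergeInto_of_pinPackage`).  The `a ↔ b` symmetry of the
package (`D_L(x)`, `Δ_{R→L}(x)`) is `pinK G b a c x`, `pinRK G b a c x` (`IsGluing4.swap_ab`).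
-/

namespace PercRepro

namespace MultiGraph

section PinnedMerge

variable {V E : Type*} (G : MultiGraph V E)

open Classical in
/-- **`Δ(G/xa) = D_K(x) + Δ_{R→K}(x)`**: the `bot`-sum of the merged graph's scores splits by the
witness `x ~ a`. -/
theorem pinK_add_pinRK [Fintype E] [DecidableEq E] (a b c x : V) :
    G.pinK a b c x + G.pinRK a b c x =
      ∑ ω : Config E, if (G.mergeInto x a).IsBot ω a b c then
        (G.mergeInto x a).hScore ω a b c else 0 := by
  unfold pinK pinRK
  rw [← Finset.sum_add_distrib]
  refine Finset.sum_congr rfl fun ω _ => ?_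
  by_cases hb : (G.mergeInto x a).IsBot ω a b c <;> by_cases hw : G.Conn ω x a <;> simp [hb, hw]

/-- **The pin package gives the D-free inequality of the merged graph `G/xa`.** -/
theorem dFreeIneq_mergeInto_of_pinPackage [Fintype E] [DecidableEq E] {a b c x : V}
    (h : G.PinPackage a b c x) : (G.mergeInto x a).DFreeIneq a b c := by
  rw [dFreeIneq_iff_sum_hScore, ← pinK_add_pinRK]
  exact add_nonneg h.1 h.2

variable {G}

/-- A 4-terminal gluing at `a, b, c, x` is one at `b, a, c, x`: the `a ↔ b` symmetry under which
`pinK G b a c x = D_L(x)` and `pinRK G b a c x = Δ_{R→L}(x)`. -/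
theorem IsGluing4.swap_ab {a b c x : V} {side : E → Bool} (hg : G.IsGluing4 a b c x side) :
    G.IsGluing4 b a c x side :=
  fun v hvb hva hvc hvx e e' he he' => hg v hva hvb hvc hvx e e' he he'

end PinnedMerge

end MultiGraph

end PercRepro
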